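import Summits.Ventures.PercRepro.RankLevelSetRuleQCellSevenSliceEightFinishA

/-!
# PercRepro — the slice `u = 8` of the cell `(q+7, q)`, part 3 (night-1, gen 18; generated by
mining/night-1/g18/stair/gen_stair.py 7 8; the previous part is RankLevelSetRuleQCellSevenSliceEightFinishA). Axioms: standard.
-/

namespace PercRepro

open Finset

/-- **(R̂) at `m = q − 8` on the cell `(q+7, q)` for every `q ≥ 14`** (`q = t + 14`, `m = t + 6`). -/
theorem rhatCell_seven_slice_eight_aux (t : ℕ) (ht : 0 ≤ t) :
    phiK (t + 6 + 8 + 7) (t + 6 + 8) ≤ rhat (t + 6 + 8) 7 (t + 6) := by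
  refine le_trans ?_ (stairSevenEight_ge (t + 6))
  set x : ℚ := ((4 : ℚ) ^ (t + 10) / ((2 * t + 20).choose (t + 10) : ℚ)) with hx
  have hx0 : 0 ≤ x := by rw [hx]; exact div_nonneg (by positivity) (Nat.cast_nonneg _)
  have hlo : ((312 : ℚ) * ((t : ℚ) + 10) + 97) / 100 ≤ x ^ 2 := (sliceEight_wallis t).1
  have hup : x ^ 2 ≤ ((315 : ℚ) * ((t : ℚ) + 10) + 74) / 100 := (sliceEight_wallis t).2
  rw [stairSevenEight_collect]
  beta_reduce
  rw [stairSevenEight_combine t x _ _ _ _ _ _ (stairSevenEight_combine_c1 t x _ _ _ (sliceEight_S1_zero t) (sliceEight_S1_one t) (sliceEight_S1_two t)) (stairSevenEight_combine_c2 t x _ _ _ (sliceEight_S1_three t) (sliceEight_S1_four t) (sliceEight_S1_five t)), stairSevenEight_phi]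
  exact stairSevenEight_finish t x ht hx0 hlo hup

/-- **The slice `u = 8` of the cell `(q+7, q)`**: `Φ(m+15, m+8) ≤ R̂(m+8, 7, m)` for every `m ≥ 6`. -/
theorem rhatCell_seven_slice_eight (m : ℕ) (hm : 6 ≤ m) :
    phiK (m + 8 + 7) (m + 8) ≤ rhat (m + 8) 7 m := by
  obtain ⟨t, rfl⟩ : ∃ t, m = t + 6 := ⟨m - 6, by omega⟩
  exact rhatCell_seven_slice_eight_aux t (by omega)

/-- The slice `u = 8` of the cell `(q+7, q)` for every `q ≥ 14`, in the `q − 8` spelling. -/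
theorem rhatCell_seven_pred_eight (q : ℕ) (hq : 14 ≤ q) : phiK (q + 7) q ≤ rhat q 7 (q - 8) := by
  obtain ⟨m, rfl⟩ : ∃ m, q = m + 8 := ⟨q - 8, by omega⟩
  rw [show m + 8 - 8 = m by omega]
  exact rhatCell_seven_slice_eight m (by omega)

/-- **The slice `u = 8` of the cell `(q+7, q)` for EVERY `q ≥ 8`**: `q = 8` is `m = 0` (`rhat_zero_eq`, equality),
`9 ≤ q ≤ 13` the kernel cells of gen 14 (`rhatCell_q_7`), `q ≥ 14` is `rhatCell_seven_pred_eight`. -/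
theorem rhat_seven_slice_eight_all (q : ℕ) (hq : 8 ≤ q) : phiK (q + 7) q ≤ rhat q 7 (q - 8) := by
  rcases Nat.lt_or_ge q 14 with hlt | hge
  · interval_cases q
    · rw [show (8 : ℕ) - 8 = 0 by rfl, rhat_zero_eq 8 7 (by norm_num)]
    · exact rhatCell_9_7 1 (by norm_num)
    · exact rhatCell_10_7 2 (by norm_num)
    · exact stairSevenEight_cell_11
    · exact stairSevenEight_cell_12
    · exact stairSevenEight_cell_13
  · exact rhatCell_seven_pred_eight q hge

end PercRepro
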